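import Literature.AlgebraicGeometry.ModuliOfAbelianVarieties.SiegelMarkedFibreTransportAlongId
import Literature.AlgebraicGeometry.AbelianSchemes.PolarizedAbelianSchemeWithLevel
import HarnessLib

/-!
# The X + level clauses of the triple transport along `𝟙 (Spec ℂ)`, in the binders of the W3 hypothesis H3
# ([Milne 2005] Thm. 6.11 / Prop. 14.12; [MFK94] Def. 7.2–7.3)

Topic `AlgebraicGeometry/ModuliOfAbelianVarieties`; namespace `Literature.AlgebraicGeometry.ModuliOfAbelianVarieties.SiegelAdelicMarking`.
Cell hodgecm-mathlib (D-0151), rung-0 W-layer: hypothesis **H3 `TripleTransportAlongId`** of the `stub_W3` assembly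
(`B-plan/lines/m1prime/M1primeOfFU.wlayer.v12…` :6439; router B-plan1 R13b/R14 (2)(b)).  THEOREMS ONLY (no definition, no
named fact, no instance, no `sorry`).  HC_CM is proved only modulo the printed citations until rung 0 closes.

* **`exists_fibreIso_isBaseChangeVia_id_triple`** — ★ `exists_fibreIso_levelStructure_isBaseChangeVia_id` (B-p21, the X +
  LEVEL half) RE-TYPED in H3's binders verbatim: triples `P′ Pσ P″ : PolarizedAbelianSchemeWithLevel g N δ (specOver ℚ ℂ).left`
  (★ D4), points `𝟙 (Spec ℂ)`, the `MarkedByWith` tower clauses of `P′`/`P″`, the transferred `f_B` with its fixed-`k`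
  compatibility clause; conclusion: a fibre iso `h` with `h.hom = jσ.hom ≫ f_B`, the group-scheme clause
  `Pσ.A.IsBaseChangeVia P″.A (𝟙 _).left H.left` and the level clause `Pσ.level.IsBaseChangeVia P″.level (𝟙 _).left H.left`
  for `H := (grpIsoOfFibreIso Pσ.A P″.A h).hom` (the conversions `(specOver ℚ ℂ).left = Spec ℂ`, `(𝟙 (specOver ℚ ℂ)).left = 𝟙`
  are definitional).
* **`exists_isBaseChangeVia_id_of_clauses`** — H3's conclusion `∃ H Ĥ, Pσ.IsBaseChangeVia P″ (𝟙 (specOver ℚ ℂ)).left H Ĥ`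
  from the level clause for that `H`, a hat morphism `Ĥ` with the hat clause and the Poincaré clause ((c-ii), dual
  transport) and the `λ`-clause ((c-iii)) — ★ D4 `PolarizedAbelianSchemeWithLevel.IsBaseChangeVia`'s four conjuncts in order.

## References
* [Milne2005ShimuraVarieties] J. S. Milne, *Introduction to Shimura varieties* (2005), §6 Thm. 6.11 pp. 74–75, §14 Prop. 14.12
  p. 125.
* [MumfordFogartyKirwan1994] D. Mumford, J. Fogarty, F. Kirwan, *Geometric Invariant Theory*, 3rd ed. (1994), Ch. 7 §2
  Definition 7.2 (p. 129), Definition 7.3 (p. 130).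
-/

set_option autoImplicit false

noncomputable section

open Matrix CategoryTheory CategoryTheory.Limits AlgebraicGeometry
open Literature.AlgebraicGeometry.Motives (AbelianVariety AlgPoints CartierDivisor)
open Literature.AlgebraicGeometry.AbelianSchemes (AbelianSchemeOver)
open Literature.AlgebraicGeometry.AbelianSchemes.AbelianSchemeOver (grpIsoOfFibreIso)

namespace Literature.AlgebraicGeometry.ModuliOfAbelianVarieties

namespace SiegelAdelicMarking

open Literature.AlgebraicGeometry.Motives (specOver)
open Literature.AlgebraicGeometry.AbelianSchemes (PolarizedAbelianSchemeWithLevel)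

variable {g N : ℕ} {δ : Fin g → ℕ} {J J' : C0pm δ} {a a' k : gspFinAdelic δ}

/-- **H3's X + LEVEL clauses, IN THE TRIPLE BINDERS** (`P′ Pσ P″ : PolarizedAbelianSchemeWithLevel g N δ (specOver ℚ ℂ).left`,
points `𝟙 (Spec ℂ)`, the `MarkedByWith` tower clauses of `P′`, `P″`, the transferred `f_B` with the fixed-`k` `ConjHomCompat`
clause — all VERBATIM as in `TripleTransportAlongId`): a fibre isomorphism `h : fibre(Pσ) ≅ fibre(P″)` with
`h.hom = jσ.hom ≫ f_B` whose induced `H := (grpIsoOfFibreIso Pσ.A P″.A h).hom` gives the group-scheme clause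
`Pσ.A.IsBaseChangeVia P″.A (𝟙 _).left H.left` and the FIRST conjunct `Pσ.level.IsBaseChangeVia P″.level (𝟙 _).left H.left` of
★ D4 `PolarizedAbelianSchemeWithLevel.IsBaseChangeVia` along `𝟙 (specOver ℚ ℂ)` (the X + LEVEL half; hat/Poincaré and `λ`
clauses are proved for the same `h` by their owners and assembled by `exists_isBaseChangeVia_id_of_clauses`).
[cite: Milne2005ShimuraVarieties, §6 Thm. 6.11 p. 74 and p. 75, §14 Prop. 14.12 p. 125]
[cite: MumfordFogartyKirwan1994, Ch. 7 §2 Definition 7.2 (p. 129) and Definition 7.3 (p. 130)] -/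
theorem exists_fibreIso_isBaseChangeVia_id_triple (hN : N ≠ 0) (σ : ℂ ≃ₐ[ℚ] ℂ)
    (hk : k ∈ principalLevelSubgroup δ N)
    (P' Pσ P'' : PolarizedAbelianSchemeWithLevel g N δ (specOver ℚ ℂ).left)
    (jσ : (Pσ.A.fibre (𝟙 (Spec (CommRingCat.of ℂ)))).toAbelianVariety ≅
      ((P'.A.fibre (𝟙 (Spec (CommRingCat.of ℂ)))).toAbelianVariety).conjugate σ.toRingEquiv)
    (hjσ : ∀ i, AlgPoints.map jσ.hom.hom.hom.hom (Pσ.A.restrictPt (𝟙 (Spec (CommRingCat.of ℂ))) (Pσ.level.σ i)) =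
      ((P'.A.fibre (𝟙 (Spec (CommRingCat.of ℂ)))).toAbelianVariety).conjPoints σ.toRingEquiv
        (P'.A.restrictPt (𝟙 (Spec (CommRingCat.of ℂ))) (P'.level.σ i)))
    (m₁ : SiegelAdelicMarking J a (P'.A.fibre (𝟙 (Spec (CommRingCat.of ℂ)))).toAbelianVariety)
    (Θ₁ : CartierDivisor (P'.A.fibre (𝟙 (Spec (CommRingCat.of ℂ)))).toAbelianVariety.X.left)
    (Λ₁ : P'.level.SymplecticLift (𝟙 (Spec (CommRingCat.of ℂ))) Θ₁ δ)
    (h₁t : ∀ ⦃M : ℕ⦄, N ∣ M → M ≠ 0 → ∀ (x : Fin g ⊕ Fin g → ZMod M) (v : Fin g ⊕ Fin g → ℚ),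
      AdelicCongr ((a⁻¹ : gspFinAdelic δ) : GL (Fin g ⊕ Fin g) finAdeleQ) 1 v (fun i => ((x i).val : ℚ) / M) →
        ((Λ₁.lift M (Multiplicative.ofAdd x)) :
          (P'.A.fibre (𝟙 (Spec (CommRingCat.of ℂ)))).toAbelianVariety.Points ℂ) = m₁.r v)
    (m₂ : SiegelAdelicMarking J' a' (P''.A.fibre (𝟙 (Spec (CommRingCat.of ℂ)))).toAbelianVariety)
    (Θ₂ : CartierDivisor (P''.A.fibre (𝟙 (Spec (CommRingCat.of ℂ)))).toAbelianVariety.X.left)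
    (Λ₂ : P''.level.SymplecticLift (𝟙 (Spec (CommRingCat.of ℂ))) Θ₂ δ)
    (h₂t : ∀ ⦃M : ℕ⦄, N ∣ M → M ≠ 0 → ∀ (x : Fin g ⊕ Fin g → ZMod M) (v : Fin g ⊕ Fin g → ℚ),
      AdelicCongr ((a'⁻¹ : gspFinAdelic δ) : GL (Fin g ⊕ Fin g) finAdeleQ) 1 v (fun i => ((x i).val : ℚ) / M) →
        ((Λ₂.lift M (Multiplicative.ofAdd x)) :
          (P''.A.fibre (𝟙 (Spec (CommRingCat.of ℂ)))).toAbelianVariety.Points ℂ) = m₂.r v)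
    (f_B : ((P'.A.fibre (𝟙 (Spec (CommRingCat.of ℂ)))).toAbelianVariety).conjugate σ.toRingEquiv ⟶
      (P''.A.fibre (𝟙 (Spec (CommRingCat.of ℂ)))).toAbelianVariety)
    (hfB : ∀ v w : Fin g ⊕ Fin g → ℚ,
      AdelicCongr ((k * a⁻¹ : gspFinAdelic δ) : GL (Fin g ⊕ Fin g) finAdeleQ)
          ((a'⁻¹ : gspFinAdelic δ) : GL (Fin g ⊕ Fin g) finAdeleQ) v w →
        AlgPoints.map f_B.hom.hom.hom
          (((P'.A.fibre (𝟙 (Spec (CommRingCat.of ℂ)))).toAbelianVariety).conjPoints σ.toRingEquiv (m₁.r v)) =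
          m₂.r w) :
    ∃ h : (Pσ.A.fibre (𝟙 (Spec (CommRingCat.of ℂ)))).toAbelianVariety ≅
        (P''.A.fibre (𝟙 (Spec (CommRingCat.of ℂ)))).toAbelianVariety,
      h.hom = jσ.hom ≫ f_B ∧
      Pσ.A.IsBaseChangeVia P''.A (𝟙 (specOver ℚ ℂ) : specOver ℚ ℂ ⟶ specOver ℚ ℂ).left
        (grpIsoOfFibreIso Pσ.A P''.A h).hom.hom.hom.left ∧
      Pσ.level.IsBaseChangeVia P''.level (𝟙 (specOver ℚ ℂ) : specOver ℚ ℂ ⟶ specOver ℚ ℂ).left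
        (grpIsoOfFibreIso Pσ.A P''.A h).hom.hom.hom.left :=
  exists_fibreIso_levelStructure_isBaseChangeVia_id hN σ hk jσ hjσ Λ₁ m₁ h₁t Λ₂ m₂ h₂t f_B hfB

/-- **H3 ASSEMBLED FROM ITS CLAUSES** (for the `stub_W3` assembler): given the fibre isomorphism `h` of
`exists_fibreIso_isBaseChangeVia_id_triple` with its LEVEL clause, a dual-side morphism `Ĥ` with the HAT clause
`Pσ.D.hat.IsBaseChangeVia P″.D.hat (𝟙 _).left Ĥ` and the POINCARÉ clause ((c-ii), dual transport), and the `λ`-clause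
`Pσ.pol.lam.left ≫ Ĥ = H.left ≫ P″.pol.lam.left` ((c-iii), polarisation rigidity) — all for `H := (grpIsoOfFibreIso Pσ.A P″.A h).hom`
— the triples are related along `𝟙 (specOver ℚ ℂ)`: `∃ H Ĥ, Pσ.IsBaseChangeVia P″ (𝟙 _).left H Ĥ`, the conclusion of
`TripleTransportAlongId` (★ D4's four conjuncts, in order). [cite: MumfordFogartyKirwan1994, Ch. 7 §2 Definition 7.2 (p. 129)]
[cite: Milne2005ShimuraVarieties, §14 Prop. 14.12 p. 125] -/
theorem exists_isBaseChangeVia_id_of_clauses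
    (Pσ P'' : PolarizedAbelianSchemeWithLevel g N δ (specOver ℚ ℂ).left)
    (h : (Pσ.A.fibre (𝟙 (Spec (CommRingCat.of ℂ)))).toAbelianVariety ≅
      (P''.A.fibre (𝟙 (Spec (CommRingCat.of ℂ)))).toAbelianVariety)
    (hL : Pσ.level.IsBaseChangeVia P''.level (𝟙 (specOver ℚ ℂ) : specOver ℚ ℂ ⟶ specOver ℚ ℂ).left
      (grpIsoOfFibreIso Pσ.A P''.A h).hom.hom.hom.left)
    (Ĥ : Pσ.D.hat.X.left ⟶ P''.D.hat.X.left)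
    (hHat : Pσ.D.hat.IsBaseChangeVia P''.D.hat (𝟙 (specOver ℚ ℂ) : specOver ℚ ℂ ⟶ specOver ℚ ℂ).left Ĥ)
    (hP : ∃ (wG : Pσ.A.X.hom ≫ (𝟙 (specOver ℚ ℂ) : specOver ℚ ℂ ⟶ specOver ℚ ℂ).left =
          (grpIsoOfFibreIso Pσ.A P''.A h).hom.hom.hom.left ≫ P''.A.X.hom)
        (wĜ : Pσ.D.hat.X.hom ≫ (𝟙 (specOver ℚ ℂ) : specOver ℚ ℂ ⟶ specOver ℚ ℂ).left = Ĥ ≫ P''.D.hat.X.hom),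
      Nonempty ((Scheme.Modules.pullback
        (pullback.map Pσ.A.X.hom Pσ.D.hat.X.hom P''.A.X.hom P''.D.hat.X.hom
          (grpIsoOfFibreIso Pσ.A P''.A h).hom.hom.hom.left Ĥ
          (𝟙 (specOver ℚ ℂ) : specOver ℚ ℂ ⟶ specOver ℚ ℂ).left wG wĜ)).obj P''.D.P ≅ Pσ.D.P))
    (hLam : Pσ.pol.lam.left ≫ Ĥ = (grpIsoOfFibreIso Pσ.A P''.A h).hom.hom.hom.left ≫ P''.pol.lam.left) :
    ∃ (H : Pσ.A.X.left ⟶ P''.A.X.left) (Ĥ : Pσ.D.hat.X.left ⟶ P''.D.hat.X.left),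
      Pσ.IsBaseChangeVia P'' (𝟙 (specOver ℚ ℂ) : specOver ℚ ℂ ⟶ specOver ℚ ℂ).left H Ĥ :=
  ⟨(grpIsoOfFibreIso Pσ.A P''.A h).hom.hom.hom.left, Ĥ, hL, hHat, hP, hLam⟩

end SiegelAdelicMarking

end Literature.AlgebraicGeometry.ModuliOfAbelianVarieties

end
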